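import Literature.AlgebraicGeometry.HodgeTheory.HypersurfaceFamilyCoordinates
import Literature.AlgebraicGeometry.HodgeTheory.RelativeResidueGluing
import Literature.AlgebraicGeometry.HodgeTheory.HypersurfaceResidueFormHolomorphic
import Literature.AlgebraicGeometry.Motives.SmoothProjectiveFamilyHolomorphicSubmersion
import Literature.Geometry.Kaehler.EhresmannChartBallTrivialisation
import Literature.Geometry.Kaehler.HolomorphicChartForms
import HarnessLib

/-!
# The glued relative residue forms of a family of smooth hypersurfaces: smooth forms on the total
# space restricting to the Griffiths residues of the fibres, with vertical `(1,0)` differential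

Family `hodge`, layer `Literature/AlgebraicGeometry/HodgeTheory`. Theorems only; no definition, no named
fact. Written by the prover seat `hodge-nonav-prover-Ax` (g12, cell `hodge-nonav`) as the instantiation
half of brick FF4 of the programme «GRIFFITHS-SURFACES / B4 RELATIVE RESIDUES» (route
`HodgeConjecture/CyclicUnitaryPowers`): the abstract gluing of `RelativeResidueGluing` (prover-Bx) fed
with the coordinates and coefficients of `HypersurfaceFamilyCoordinates` on the total space of the
specialised family of smooth hypersurfaces `f = familySpz ℂ n d sp : 𝒴_sp ⟶ S_sp` (Voisin II §6.2.1;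
the Carlson–Toledo family of cyclic covers is `sp = cyclicCoverSpz p`).

Main statements (`exists_relativeResidueForms_familySpz_of_isHomogeneous`, one homogeneous numerator `P`, and
`exists_relativeResidueForms_familySpz`, all monomials): for `n = n₀ + 1`, `d ≥ n + 2` and every base
point `t₁ ∈ S_sp(ℂ)`, there are an open `O ∋ t₁` and, for every monomial `x^μ` of degree `d − n − 2`, a
SMOOTH complex `n`-form `Ξ_μ` on the complex manifold `𝒴_sp(ℂ)` (algebraic charts) such that

* on every fibre `X_b`, `b ∈ O` (algebraic charts), `(X_b ↪ 𝒴_sp)^* Ξ_μ` IS the Griffiths residue form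
  `Res(x^μ Ω / F_b)` of the hypersurface `X_b = {F_b = 0} ⊂ ℙⁿ⁺¹` (`residueForm`), a CLOSED form
  holomorphic in charts;
* along the fibres over `O`, `dΞ_μ` is `ℂ`-linear in its transverse slot on `dπ`-vertical arguments —
  the hypotheses `hΞ`, `hΞc`, `hdΞ` of `PeriodsOfRelativeFormsHolomorphic` (brick F-C).

Construction: `Ξ_μ = Σ_{(i,j)} χ_{ij} · (x^μ(Z̃ᵢ)/∂_jF(Z̃ᵢ)) det(e_j, Z̃ᵢ, dZ̃ᵢ ·)` with a smooth partition
of unity `χ` subordinate to the admissible charts, `= 1` on a compact tube `π⁻¹ K` around the fibre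
over `t₁` (`exists_partition_adapted_relResidue`; every point of the total space is admissible for some
`(i, j)` by the Jacobian criterion, `exists_admissible_totalSpz`); smoothness, restriction and the
`(1,0)`-condition are prover-Bx's `isSmoothForm_sum_smul_relResidue`,
`pullback_sum_smul_relResidue_eq_residueForm`, `mextDeriv_sum_smul_relResidue_cons_I_smul_of_fibreEmbeddings`
(kernel form of verticality via `exists_mfderiv_eq_of_mfderiv_proj_eq_zero`). Nothing here says HC is proved.

## References

* [Griffiths1969] P. Griffiths, On the periods of certain rational integrals I, Ann. of Math. 90 (1969), §8.
* [VoisinHodgeII2003] C. Voisin, Hodge Theory and Complex Algebraic Geometry II (2003), §6.1.3, §6.2.1.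
* [VoisinHodgeI2002] C. Voisin, Hodge Theory and Complex Algebraic Geometry I (2002), §10.2.2.
-/

noncomputable section

open scoped Manifold ContDiff Topology LinearAlgebra.Projectivization
open CategoryTheory AlgebraicGeometry Set Filter Complex
open Literature.NumberTheory.Transcendental Projectivization
open Literature.Geometry.Kaehler Literature.AlgebraicGeometry.Motives
open Literature.AlgebraicGeometry.Motives.UniversalHypersurface
open Literature.AlgebraicGeometry.HodgeTheory.UniversalHypersurface

namespace Literature.AlgebraicGeometry.HodgeTheory

-- The identification `TangentSpace I x = E` is an abuse of definitional equality; as in the tree's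
-- form files we let `isDefEq` unfold it.
set_option backward.isDefEq.respectTransparency false

section Admissible

variable (n d : ℕ) {σ : Type} (sp : CoeffRing ℂ n d →ₐ[ℂ] MvPolynomial σ ℂ)

/-- **Every point of the total space is admissible for some pair `(i, j)`**: some homogeneous coordinate
`zᵢ` of `ψ_T y` is non-zero, and since `Z̃ᵢ y` is a non-zero zero of the NONSINGULAR equation `F_y` of
the fibre through `y`, some partial `∂_jF_y(Z̃ᵢ y)` is non-zero (Jacobian criterion).
[cite: VoisinHodgeII2003, §6.2.1] -/
theorem exists_admissible_totalSpz (hd : 1 ≤ d) (y : ComplexPoints (totalSpz ℂ n d sp)) :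
    ∃ p : Fin (n + 2) × Fin (n + 2),
      y ∈ liftDomain (hypersurfacePoint (totalSpzToTotal ℂ n d sp ≫ toProjectiveSpace ℂ n d)) p.1 ∧
      MvPolynomial.eval (projLift (hypersurfacePoint (totalSpzToTotal ℂ n d sp ≫ toProjectiveSpace ℂ n d)) p.1 y)
        (MvPolynomial.pderiv p.2 (∑ m : DegIndex n d,
          coeffVector ℂ n d (AlgPoints.map (family ℂ n d) (AlgPoints.map (totalSpzToTotal ℂ n d sp) y)) m •
            MvPolynomial.monomial m.1 (1 : ℂ))) ≠ 0 := by
  set ψ := hypersurfacePoint (totalSpzToTotal ℂ n d sp ≫ toProjectiveSpace ℂ n d) with hψ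
  obtain ⟨i, hi⟩ := exists_mem_liftDomain ψ y
  rw [← pointForm_eq_sum_coeffVector_smul_monomial, map_totalSpzToTotal_family]
  set t := AlgPoints.map (familySpz ℂ n d sp) y
  have hF := isHomogeneous_pointForm ℂ n d (AlgPoints.map (toBaseSpz ℂ n d sp) t)
  have hmem : ψ y ∈ projZeroLocus {pointFormSpz ℂ n d sp t} :=
    hypersurfacePoint_totalSpz_mem_projZeroLocus n d sp hd y
  have hz : MvPolynomial.eval (projLift ψ i y) (pointFormSpz ℂ n d sp t) = 0 := by
    refine eval_projLift_eq_zero (fun _ : Unit ↦ ψ y) hF ?_ (i := i) (x := ()) hi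
    rintro _ ⟨_, rfl⟩; exact hmem
  obtain ⟨j, hj⟩ := exists_eval_pderiv_pointFormSpz_ne_zero n d sp t _ (projLift_ne_zero ψ i y) hz
  exact ⟨(i, j), hi, hj⟩

end Admissible

section Forms

variable (n₀ d : ℕ) {σ : Type} (sp : CoeffRing ℂ (n₀ + 1) d →ₐ[ℂ] MvPolynomial σ ℂ)

/-- `𝒴_sp(ℂ)` is second countable: `𝒴_sp` is quasi-compact (proper over the quasi-compact base
`S_sp ⊆ 𝔸^σ`, `σ` finite), and the complex points of a quasi-compact `ℂ`-scheme locally of finite type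
are second countable. [cite: SerreGAGA1956, §2 n°5 Prop. 2] [cite: Hartshorne1977, II Ex. 2.13] -/
theorem secondCountableTopology_complexPoints_totalSpz [Finite σ] {k : ℕ}
    (hf : IsSmoothProjectiveFamily (familySpz ℂ (n₀ + 1) d sp) k) :
    SecondCountableTopology (ComplexPoints (totalSpz ℂ (n₀ + 1) d sp)) := by
  haveI : IsProper (familySpz ℂ (n₀ + 1) d sp).left := hf.isProper
  haveI : LocallyOfFiniteType (baseSpz ℂ (n₀ + 1) d sp).hom := locallyOfFiniteType_baseSpz_hom ℂ (n₀ + 1) d sp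
  haveI : LocallyOfFiniteType (totalSpz ℂ (n₀ + 1) d sp).hom := by
    rw [show (totalSpz ℂ (n₀ + 1) d sp).hom =
      (familySpz ℂ (n₀ + 1) d sp).left ≫ (baseSpz ℂ (n₀ + 1) d sp).hom from
      (Over.w (familySpz ℂ (n₀ + 1) d sp)).symm]
    infer_instance
  have hS := isQuasiProjectiveOver_baseSpz (n₀ + 1) d sp
  haveI : AlgebraicGeometry.QuasiCompact (baseSpz ℂ (n₀ + 1) d sp).hom :=
    hS.isVarietyPair_ofScheme.quasiCompact
  haveI : CompactSpace (baseSpz ℂ (n₀ + 1) d sp).left :=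
    QuasiCompact.compactSpace_of_compactSpace (baseSpz ℂ (n₀ + 1) d sp).hom
  haveI : CompactSpace (totalSpz ℂ (n₀ + 1) d sp).left :=
    QuasiCompact.compactSpace_of_compactSpace (familySpz ℂ (n₀ + 1) d sp).left
  exact ComplexPoints.secondCountableTopology_of_compactSpace_holds _

/-- **The glued relative residue form with an arbitrary homogeneous numerator.** Same as
`exists_relativeResidueForms_familySpz` below, for ONE numerator `P` homogeneous of degree `d − n − 2`
(e.g. a member of a basis of `S^{d−n−2}`, as in `residueFrame_of_hypersurfacePoint`), the open `O ∋ t₁`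
being uniform in `P`: a smooth `n`-form `Ξ` on `𝒴_sp(ℂ)` with (i) `IsSmoothForm Ξ`; (ii) over `b ∈ O` the
pull-back to `X_b(ℂ)` is `residueForm ψ_b F_b P = ψ_b^* Res(PΩ/F_b)`; (iii) that residue form is
holomorphic in charts and the pull-back is closed; (iv) the vertical `(1,0)`-condition of `dΞ` over `O`.
[cite: Griffiths1969, §8] [cite: VoisinHodgeII2003, §6.1.3 and §6.2.1] [cite: VoisinHodgeI2002, §10.2.2] -/
theorem exists_relativeResidueForms_familySpz_of_isHomogeneous [Finite σ] (hd : n₀ + 1 + 2 ≤ d) (m : ℕ)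
    [AlgebraicGeometry.SmoothOfRelativeDimension m (baseSpz ℂ (n₀ + 1) d sp).hom]
    (hf : IsSmoothProjectiveFamily (familySpz ℂ (n₀ + 1) d sp) (n₀ + 1))
    (t₁ : ComplexPoints (baseSpz ℂ (n₀ + 1) d sp)) :
    letI := smoothOfRelativeDimension_total (m := m) (familySpz ℂ (n₀ + 1) d sp) hf
    letI : Smooth (totalSpz ℂ (n₀ + 1) d sp).hom := SmoothOfRelativeDimension.smooth (n₀ + 1 + m) _
    letI : LocallyOfFiniteType (totalSpz ℂ (n₀ + 1) d sp).hom := inferInstance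
    letI : Smooth (baseSpz ℂ (n₀ + 1) d sp).hom := SmoothOfRelativeDimension.smooth m _
    letI : LocallyOfFiniteType (baseSpz ℂ (n₀ + 1) d sp).hom := inferInstance
    letI := chartedSpaceOfCharts (ComplexPoints.algebraicChart (totalSpz ℂ (n₀ + 1) d sp) (n₀ + 1 + m))
      (ComplexPoints.mem_algebraicChart_source (totalSpz ℂ (n₀ + 1) d sp) (n₀ + 1 + m))
    letI := chartedSpaceOfCharts (ComplexPoints.algebraicChart (baseSpz ℂ (n₀ + 1) d sp) m)
      (ComplexPoints.mem_algebraicChart_source (baseSpz ℂ (n₀ + 1) d sp) m)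
    letI : ∀ b : ComplexPoints (baseSpz ℂ (n₀ + 1) d sp),
        ChartedSpace (Fin (n₀ + 1) → ℂ) (ComplexPoints (fiberOver (familySpz ℂ (n₀ + 1) d sp) b)) :=
      fun b ↦ (algebraicModel (hf.isSmoothProjective b)).chartedSpace
    ∃ O : Set (ComplexPoints (baseSpz ℂ (n₀ + 1) d sp)), IsOpen O ∧ t₁ ∈ O ∧
      ∀ P : MvPolynomial (Fin (n₀ + 1 + 2)) ℂ, P.IsHomogeneous (d - (n₀ + 1 + 2)) →
      ∃ Ξ : MForm 𝓘(ℝ, Fin (n₀ + 1 + m) → ℂ) (ComplexPoints (totalSpz ℂ (n₀ + 1) d sp)) ℂ (n₀ + 1),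
      IsSmoothForm Ξ ∧
      (∀ b ∈ O,
        Ξ.pullback 𝓘(ℝ, Fin (n₀ + 1) → ℂ) (AlgPoints.map (fiberι (familySpz ℂ (n₀ + 1) d sp) b)) =
          residueForm (hypersurfacePoint (fiberι (familySpz ℂ (n₀ + 1) d sp) b ≫
              totalSpzToTotal ℂ (n₀ + 1) d sp ≫ toProjectiveSpace ℂ (n₀ + 1) d))
            (pointFormSpz ℂ (n₀ + 1) d sp b) P) ∧
      (∀ b ∈ O,
        IsHolomorphicInCharts (residueForm (E := Fin (n₀ + 1) → ℂ)
          (hypersurfacePoint (fiberι (familySpz ℂ (n₀ + 1) d sp) b ≫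
              totalSpzToTotal ℂ (n₀ + 1) d sp ≫ toProjectiveSpace ℂ (n₀ + 1) d))
            (pointFormSpz ℂ (n₀ + 1) d sp b) P) ∧
        IsClosedForm (Ξ.pullback 𝓘(ℝ, Fin (n₀ + 1) → ℂ)
          (AlgPoints.map (fiberι (familySpz ℂ (n₀ + 1) d sp) b)))) ∧
      (∀ (y : ComplexPoints (totalSpz ℂ (n₀ + 1) d sp)),
        AlgPoints.map (familySpz ℂ (n₀ + 1) d sp) y ∈ O →
        ∀ (v : Fin (n₀ + 1 + m) → ℂ) (w : Fin (n₀ + 1) → (Fin (n₀ + 1 + m) → ℂ)),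
        (∀ i, mfderiv 𝓘(ℝ, Fin (n₀ + 1 + m) → ℂ) 𝓘(ℝ, Fin m → ℂ)
          (AlgPoints.map (familySpz ℂ (n₀ + 1) d sp)) y (w i) = 0) →
        (show (Fin (n₀ + 1 + m) → ℂ) [⋀^Fin (n₀ + 1 + 1)]→L[ℝ] ℂ from mextDeriv Ξ y)
            (Fin.cons (I • v) w) =
          I * (show (Fin (n₀ + 1 + m) → ℂ) [⋀^Fin (n₀ + 1 + 1)]→L[ℝ] ℂ from mextDeriv Ξ y)
            (Fin.cons v w)) := by
  set f := familySpz ℂ (n₀ + 1) d sp with hfdef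
  haveI := smoothOfRelativeDimension_total (m := m) f hf
  haveI : Smooth (totalSpz ℂ (n₀ + 1) d sp).hom := SmoothOfRelativeDimension.smooth (n₀ + 1 + m) _
  haveI : LocallyOfFiniteType (totalSpz ℂ (n₀ + 1) d sp).hom := inferInstance
  haveI : Smooth (baseSpz ℂ (n₀ + 1) d sp).hom := SmoothOfRelativeDimension.smooth m _
  haveI : LocallyOfFiniteType (baseSpz ℂ (n₀ + 1) d sp).hom := inferInstance
  haveI : IsSeparated (baseSpz ℂ (n₀ + 1) d sp).hom := isSeparated_baseSpz_hom ℂ (n₀ + 1) d sp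
  haveI : Smooth f.left := hf.smooth
  haveI : IsProper f.left := hf.isProper
  letI csT := chartedSpaceOfCharts (ComplexPoints.algebraicChart (totalSpz ℂ (n₀ + 1) d sp) (n₀ + 1 + m))
    (ComplexPoints.mem_algebraicChart_source (totalSpz ℂ (n₀ + 1) d sp) (n₀ + 1 + m))
  letI csB := chartedSpaceOfCharts (ComplexPoints.algebraicChart (baseSpz ℂ (n₀ + 1) d sp) m)
    (ComplexPoints.mem_algebraicChart_source (baseSpz ℂ (n₀ + 1) d sp) m)
  letI csX : ∀ b : ComplexPoints (baseSpz ℂ (n₀ + 1) d sp),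
      ChartedSpace (Fin (n₀ + 1) → ℂ) (ComplexPoints (fiberOver f b)) :=
    fun b ↦ (algebraicModel (hf.isSmoothProjective b)).chartedSpace
  haveI : IsManifold 𝓘(ℂ, Fin (n₀ + 1 + m) → ℂ) ω (ComplexPoints (totalSpz ℂ (n₀ + 1) d sp)) :=
    isManifold_algebraicChart _ _
  haveI : IsManifold 𝓘(ℝ, Fin (n₀ + 1 + m) → ℂ) ∞ (ComplexPoints (totalSpz ℂ (n₀ + 1) d sp)) :=
    isManifold_real_of_isManifold_complex
  haveI : IsManifold 𝓘(ℂ, Fin m → ℂ) ω (ComplexPoints (baseSpz ℂ (n₀ + 1) d sp)) :=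
    isManifold_algebraicChart _ _
  haveI : ∀ b, IsManifold 𝓘(ℂ, Fin (n₀ + 1) → ℂ) ω (ComplexPoints (fiberOver f b)) :=
    fun b ↦ isManifold_fibre_algebraicModel f b (hf.isSmoothProjective b)
  haveI : ∀ b, IsManifold 𝓘(ℝ, Fin (n₀ + 1) → ℂ) ∞ (ComplexPoints (fiberOver f b)) :=
    fun b ↦ isManifold_real_of_isManifold_complex
  haveI : T2Space (ComplexPoints (baseSpz ℂ (n₀ + 1) d sp)) := ComplexPoints.t2Space_of_isSeparated _
  have hπ := isProperHolomorphicSubmersion_map_algebraicChart (e := n₀ + 1 + m) (m := m) f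
  have hιall : ∀ b, IsFibreEmbedding (Fin (n₀ + 1) → ℂ) (Fin (n₀ + 1 + m) → ℂ)
      (AlgPoints.map f : ComplexPoints (totalSpz ℂ (n₀ + 1) d sp) → ComplexPoints (baseSpz ℂ (n₀ + 1) d sp))
      b (AlgPoints.map (fiberι f b)) :=
    fun b ↦ isFibreEmbedding_map_fiberι f b (hf.isSmoothProjective b)
  haveI : T2Space (ComplexPoints (totalSpz ℂ (n₀ + 1) d sp)) := by
    haveI : IsSeparated (totalSpz ℂ (n₀ + 1) d sp).hom := by
      rw [show (totalSpz ℂ (n₀ + 1) d sp).hom = f.left ≫ (baseSpz ℂ (n₀ + 1) d sp).hom from (Over.w f).symm]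
      infer_instance
    exact ComplexPoints.t2Space_of_isSeparated _
  haveI : LocallyCompactSpace (ComplexPoints (totalSpz ℂ (n₀ + 1) d sp)) :=
    ChartedSpace.locallyCompactSpace (Fin (n₀ + 1 + m) → ℂ) _
  -- σ-compactness of the total space: proper over the σ-compact base `S_sp(ℂ)` (quasi-projective)
  haveI : SigmaCompactSpace (ComplexPoints (totalSpz ℂ (n₀ + 1) d sp)) := by
    haveI := secondCountableTopology_complexPoints_totalSpz n₀ d sp hf
    exact sigmaCompactSpace_of_locallyCompact_secondCountable
  -- ### the data of `RelativeResidueGluing` on the total space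
  set ιT := totalSpzToTotal ℂ (n₀ + 1) d sp ≫ toProjectiveSpace ℂ (n₀ + 1) d with hιT
  set ψ : ComplexPoints (totalSpz ℂ (n₀ + 1) d sp) → ℙ ℂ (Fin (n₀ + 1 + 2) → ℂ) := hypersurfacePoint ιT
    with hψdef
  have hψ : Continuous ψ := continuous_hypersurfacePoint _
  have hφT : IsAnalytification (Fin (n₀ + 1 + m) → ℂ) (totalSpz ℂ (n₀ + 1) d sp) (n₀ + 1 + m)
      (id : ComplexPoints (totalSpz ℂ (n₀ + 1) d sp) → _) := isAnalytification_algebraicChart _ _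
  have hhol : HasHolomorphicCoords (Fin (n₀ + 1 + m) → ℂ) ψ := hasHolomorphicCoords_totalSpz (n₀ + 1) d sp hφT
  set c : DegIndex (n₀ + 1) d → ComplexPoints (totalSpz ℂ (n₀ + 1) d sp) → ℂ := fun m' y ↦
    coeffVector ℂ (n₀ + 1) d (AlgPoints.map (family ℂ (n₀ + 1) d) (AlgPoints.map (totalSpzToTotal ℂ (n₀ + 1) d sp) y)) m'
    with hcdef
  have hc : ∀ m', MDifferentiable 𝓘(ℂ, Fin (n₀ + 1 + m) → ℂ) 𝓘(ℂ, ℂ) (c m') :=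
    fun m' ↦ mdifferentiable_coeff_totalSpz (n₀ + 1) d sp hφT m'
  set G : DegIndex (n₀ + 1) d → MvPolynomial (Fin (n₀ + 1 + 2)) ℂ := fun m' ↦ MvPolynomial.monomial m'.1 1
    with hGdef
  -- the equation of the fibre through `y`
  have hFy : ∀ y, (∑ m', c m' y • G m') =
      pointFormSpz ℂ (n₀ + 1) d sp (AlgPoints.map f y) := by
    intro y
    rw [hcdef, hGdef]
    simp only
    rw [← pointForm_eq_sum_coeffVector_smul_monomial, map_totalSpzToTotal_family]
  have hd1 : 1 ≤ d := by omega
  -- ### the compact tube around the fibre over `t₁` and the open `O`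
  set cB := extChartAt 𝓘(ℂ, Fin m → ℂ) t₁ with hcB
  obtain ⟨ρ, hρ, hρt⟩ : ∃ ρ > 0, Metric.closedBall (cB t₁) ρ ⊆ cB.target := by
    obtain ⟨ρ, hρ, h⟩ := Metric.nhds_basis_closedBall.mem_iff.1 (extChartAt_target_mem_nhds (I := 𝓘(ℂ, Fin m → ℂ)) t₁)
    exact ⟨ρ, hρ, h⟩
  set O : Set (ComplexPoints (baseSpz ℂ (n₀ + 1) d sp)) := cB.source ∩ cB ⁻¹' Metric.ball (cB t₁) ρ with hO
  have hOo : IsOpen O :=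
    (continuousOn_extChartAt t₁).isOpen_inter_preimage (isOpen_extChartAt_source t₁) Metric.isOpen_ball
  have ht₁O : t₁ ∈ O := ⟨mem_extChartAt_source t₁, by simp [hρ]⟩
  set KB : Set (ComplexPoints (baseSpz ℂ (n₀ + 1) d sp)) := cB.symm '' Metric.closedBall (cB t₁) ρ with hKB
  have hKBc : IsCompact KB :=
    (isCompact_closedBall _ _).image_of_continuousOn ((continuousOn_extChartAt_symm t₁).mono hρt)
  have hOKB : O ⊆ KB := by
    rintro b ⟨hb, hb'⟩
    exact ⟨cB b, Metric.ball_subset_closedBall hb', cB.left_inv hb⟩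
  set K : Set (ComplexPoints (totalSpz ℂ (n₀ + 1) d sp)) := AlgPoints.map f ⁻¹' KB with hK
  have hKc : IsCompact K := hπ.isProperMap.isCompact_preimage hKBc
  -- ### the partition of unity and the glued forms
  have hcover : ∀ y ∈ K, ∃ p : Fin (n₀ + 1 + 2) × Fin (n₀ + 1 + 2), y ∈ liftDomain ψ p.1 ∧
      MvPolynomial.eval (projLift ψ p.1 y) (MvPolynomial.pderiv p.2 (∑ m', c m' y • G m')) ≠ 0 :=
    fun y _ ↦ exists_admissible_totalSpz (n₀ + 1) d sp hd1 y
  obtain ⟨G', χ, hG'o, hKG', hχs, hχsupp, -, hχ1⟩ :=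
    exists_partition_adapted_relResidue ψ G c hψ hhol hc hKc hcover
  -- admissible sets and local forms
  set U : Fin (n₀ + 1 + 2) × Fin (n₀ + 1 + 2) → Set (ComplexPoints (totalSpz ℂ (n₀ + 1) d sp)) := fun p ↦
    {y ∈ liftDomain ψ p.1 | MvPolynomial.eval (projLift ψ p.1 y) (MvPolynomial.pderiv p.2 (∑ m', c m' y • G m')) ≠ 0}
    with hU
  have hUadm : ∀ p, ∀ y ∈ U p, y ∈ liftDomain ψ p.1 ∧
      MvPolynomial.eval (projLift ψ p.1 y) (MvPolynomial.pderiv p.2 (∑ m', c m' y • G m')) ≠ 0 :=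
    fun p y hy ↦ hy
  -- the fibre `X_b ↪ 𝒴_sp ⟶ ℙⁿ⁺¹` is the smooth hypersurface `{F_b = 0}`
  have hrangeb : ∀ b, Set.range (ψ ∘ AlgPoints.map (fiberι f b)) ⊆
      projZeroLocus {pointFormSpz ℂ (n₀ + 1) d sp b} := by
    rintro b _ ⟨x', rfl⟩
    rw [← range_hypersurfacePoint_fiberι_totalSpz (n₀ + 1) d sp hd1 b]
    refine ⟨x', ?_⟩
    simp only [hψdef, Function.comp_apply, hιT, hypersurfacePoint_comp]
    rfl
  refine ⟨O, hOo, ht₁O, fun P hP ↦ ?_⟩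
  set ΞF : Fin (n₀ + 1 + 2) × Fin (n₀ + 1 + 2) →
      MForm 𝓘(ℝ, Fin (n₀ + 1 + m) → ℂ) (ComplexPoints (totalSpz ℂ (n₀ + 1) d sp)) ℂ (n₀ + 1) :=
    fun p y ↦ show (Fin (n₀ + 1 + m) → ℂ) [⋀^Fin (n₀ + 1)]→L[ℝ] ℂ from
      (residueFormula ψ (∑ m', c m' y • G m') P p.1 p.2 y).restrictScalars ℝ
    with hΞF
  have hΞF' : ∀ p y, ΞF p y = (show (Fin (n₀ + 1 + m) → ℂ) [⋀^Fin (n₀ + 1)]→L[ℝ] ℂ from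
      (residueFormula ψ (∑ m', c m' y • G m') P p.1 p.2 y).restrictScalars ℝ) :=
    fun _ _ ↦ rfl
  have hholfib : ∀ b,
      IsHolomorphicInCharts (residueForm (E := Fin (n₀ + 1) → ℂ)
        (hypersurfacePoint (fiberι f b ≫ ιT)) (pointFormSpz ℂ (n₀ + 1) d sp b) P) := by
    intro b
    haveI := (hf.isSmoothProjective b).smoothOfRelativeDimension
    haveI : Smooth (fiberOver f b).hom := SmoothOfRelativeDimension.smooth (n₀ + 1) _
    haveI : LocallyOfFiniteType (fiberOver f b).hom := inferInstance
    have hholb : HasHolomorphicCoords (Fin (n₀ + 1) → ℂ) (hypersurfacePoint (fiberι f b ≫ ιT)) :=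
      hasHolomorphicCoords_hypersurfacePoint_comp (fiberι f b ≫ ιT)
        (algebraicModel (hf.isSmoothProjective b)).isAnalytification
    refine isHolomorphicInCharts_residueForm (hypersurfacePoint (fiberι f b ≫ ιT))
      (isHomogeneous_pointForm ℂ (n₀ + 1) d _)
      (continuous_hypersurfacePoint _) ?_ (exists_eval_pderiv_pointFormSpz_ne_zero (n₀ + 1) d sp b)
      hholb hP hd
    rintro _ ⟨x', rfl⟩
    exact hrangeb b ⟨x', by simp only [hψdef, Function.comp_apply, hιT, hypersurfacePoint_comp]⟩
  -- (ii) restriction to the fibres over `O`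
  have hii : ∀ b ∈ O,
      (∑ p, χ p • ΞF p).pullback 𝓘(ℝ, Fin (n₀ + 1) → ℂ) (AlgPoints.map (fiberι f b)) =
        residueForm (hypersurfacePoint (fiberι f b ≫ ιT)) (pointFormSpz ℂ (n₀ + 1) d sp b) P := by
    intro b hb
    have hιb := hιall b
    funext x
    have hx : ∑ p, χ p (AlgPoints.map (fiberι f b) x) = 1 := by
      refine hχ1 _ (hKG' ?_)
      change AlgPoints.map f (AlgPoints.map (fiberι f b) x) ∈ KB
      rw [AlgPoints.map_map_fiberι]
      exact hOKB hb
    have h := pullback_sum_smul_relResidue_eq_residueForm ψ G c P hψ hhol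
      hΞF' hUadm hχsupp (ι := AlgPoints.map (fiberι f b)) (AlgPoints.continuous_map _)
      (hιb.contMDiff.mdifferentiable (by simp)) (isHomogeneous_pointForm ℂ (n₀ + 1) d _)
      (exists_eval_pderiv_pointFormSpz_ne_zero (n₀ + 1) d sp b)
      (fun x ↦ by rw [hFy, AlgPoints.map_map_fiberι]) (hrangeb b) hP hd hx
    rw [h]
    congr 1
  refine ⟨∑ p, χ p • ΞF p, ?_, hii, fun b hb ↦ ⟨hholfib b, ?_⟩, ?_⟩
  · -- (i) smoothness
    exact isSmoothForm_sum_smul_relResidue ψ G c _ hψ hhol hc hΞF' hUadm hχs hχsupp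
  · -- (iii) closedness of the pull-back: a holomorphic form of top holomorphic degree is closed
    rw [hii b hb]
    exact (hholfib b).isClosedForm (by simp)
  · -- (iv) the vertical `(1,0)`-condition over `O`
    intro y hyO v w hw
    have hyG : y ∈ G' := hKG' (hOKB hyO)
    refine mextDeriv_sum_smul_relResidue_cons_I_smul_of_fibreEmbeddings ψ G c
      P (AlgPoints.map f) (fun b ↦ ComplexPoints (fiberOver f b))
      (fun b ↦ AlgPoints.map (fiberι f b)) hψ hhol hc hΞF' hUadm hχs hχsupp hG'o hχ1
      (AlgPoints.continuous_map f) hOo (fun b _ ↦ hιall b) (fun b ↦ pointFormSpz ℂ (n₀ + 1) d sp b)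
      (fun b _ ↦ isHomogeneous_pointForm ℂ (n₀ + 1) d _)
      (fun b _ ↦ exists_eval_pderiv_pointFormSpz_ne_zero (n₀ + 1) d sp b)
      (fun b _ x ↦ by rw [hFy, AlgPoints.map_map_fiberι]) (fun b _ ↦ hrangeb b) hP hd hyG hyO v w
      fun k ↦ ?_
    obtain ⟨x, hx⟩ : y ∈ Set.range (AlgPoints.map (fiberι f (AlgPoints.map f y))) := by
      rw [(hιall _).range_eq]; rfl
    obtain ⟨u', hu'⟩ := exists_mfderiv_eq_of_mfderiv_proj_eq_zero hπ (hιall _)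
      (finrank_fibre_add_base (n₀ + 1) m) x (w k) (by rw [hx]; exact hw k)
    exact ⟨x, u', hx, hu'⟩

/-- **The glued relative residue forms of the family `𝒴_sp ⟶ S_sp` of smooth hypersurfaces** (see the
module docstring). For `n = n₀ + 1`, `d ≥ n + 2`, a base smooth of relative dimension `m`, and a base point
`t₁`: an open `O ∋ t₁` and, for every `μ` (monomial `x^μ` of degree `d − n − 2`), a smooth `n`-form `Ξ μ` on
`𝒴_sp(ℂ)` (algebraic charts, model `ℂ^{n+m}`) with: (i) `IsSmoothForm (Ξ μ)`; (ii) for `b ∈ O`, the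
pull-back to the fibre `X_b(ℂ)` (algebraic charts) is the residue form
`residueForm ψ_b F_b x^μ = ψ_b^* Res(x^μ Ω/F_b)`, `ψ_b = hypersurfacePoint (X_b ⟶ 𝒴_sp ⟶ 𝒴_U ⟶ ℙⁿ⁺¹)`,
`F_b = pointFormSpz b`; (iii) that residue form is holomorphic in charts and the pull-back is CLOSED;
(iv) the vertical `(1,0)`-condition of `d(Ξ μ)` at every point over `O`, in the kernel form of
`PeriodsOfRelativeFormsHolomorphic`. [cite: Griffiths1969, §8] [cite: VoisinHodgeII2003, §6.1.3 and §6.2.1]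
[cite: VoisinHodgeI2002, §10.2.2] -/
theorem exists_relativeResidueForms_familySpz [Finite σ] (hd : n₀ + 1 + 2 ≤ d) (m : ℕ)
    [AlgebraicGeometry.SmoothOfRelativeDimension m (baseSpz ℂ (n₀ + 1) d sp).hom]
    (hf : IsSmoothProjectiveFamily (familySpz ℂ (n₀ + 1) d sp) (n₀ + 1))
    (t₁ : ComplexPoints (baseSpz ℂ (n₀ + 1) d sp)) :
    letI := smoothOfRelativeDimension_total (m := m) (familySpz ℂ (n₀ + 1) d sp) hf
    letI : Smooth (totalSpz ℂ (n₀ + 1) d sp).hom := SmoothOfRelativeDimension.smooth (n₀ + 1 + m) _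
    letI : LocallyOfFiniteType (totalSpz ℂ (n₀ + 1) d sp).hom := inferInstance
    letI : Smooth (baseSpz ℂ (n₀ + 1) d sp).hom := SmoothOfRelativeDimension.smooth m _
    letI : LocallyOfFiniteType (baseSpz ℂ (n₀ + 1) d sp).hom := inferInstance
    letI := chartedSpaceOfCharts (ComplexPoints.algebraicChart (totalSpz ℂ (n₀ + 1) d sp) (n₀ + 1 + m))
      (ComplexPoints.mem_algebraicChart_source (totalSpz ℂ (n₀ + 1) d sp) (n₀ + 1 + m))
    letI := chartedSpaceOfCharts (ComplexPoints.algebraicChart (baseSpz ℂ (n₀ + 1) d sp) m)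
      (ComplexPoints.mem_algebraicChart_source (baseSpz ℂ (n₀ + 1) d sp) m)
    letI : ∀ b : ComplexPoints (baseSpz ℂ (n₀ + 1) d sp),
        ChartedSpace (Fin (n₀ + 1) → ℂ) (ComplexPoints (fiberOver (familySpz ℂ (n₀ + 1) d sp) b)) :=
      fun b ↦ (algebraicModel (hf.isSmoothProjective b)).chartedSpace
    ∃ O : Set (ComplexPoints (baseSpz ℂ (n₀ + 1) d sp)), IsOpen O ∧ t₁ ∈ O ∧
      ∃ Ξ : DegIndex (n₀ + 1) (d - (n₀ + 1 + 2)) →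
        MForm 𝓘(ℝ, Fin (n₀ + 1 + m) → ℂ) (ComplexPoints (totalSpz ℂ (n₀ + 1) d sp)) ℂ (n₀ + 1),
      (∀ μ, IsSmoothForm (Ξ μ)) ∧
      (∀ μ, ∀ b ∈ O,
        (Ξ μ).pullback 𝓘(ℝ, Fin (n₀ + 1) → ℂ) (AlgPoints.map (fiberι (familySpz ℂ (n₀ + 1) d sp) b)) =
          residueForm (hypersurfacePoint (fiberι (familySpz ℂ (n₀ + 1) d sp) b ≫
              totalSpzToTotal ℂ (n₀ + 1) d sp ≫ toProjectiveSpace ℂ (n₀ + 1) d))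
            (pointFormSpz ℂ (n₀ + 1) d sp b) (MvPolynomial.monomial μ.1 1)) ∧
      (∀ μ, ∀ b ∈ O,
        IsHolomorphicInCharts (residueForm (E := Fin (n₀ + 1) → ℂ)
          (hypersurfacePoint (fiberι (familySpz ℂ (n₀ + 1) d sp) b ≫
              totalSpzToTotal ℂ (n₀ + 1) d sp ≫ toProjectiveSpace ℂ (n₀ + 1) d))
            (pointFormSpz ℂ (n₀ + 1) d sp b) (MvPolynomial.monomial μ.1 1)) ∧
        IsClosedForm ((Ξ μ).pullback 𝓘(ℝ, Fin (n₀ + 1) → ℂ)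
          (AlgPoints.map (fiberι (familySpz ℂ (n₀ + 1) d sp) b)))) ∧
      (∀ μ (y : ComplexPoints (totalSpz ℂ (n₀ + 1) d sp)),
        AlgPoints.map (familySpz ℂ (n₀ + 1) d sp) y ∈ O →
        ∀ (v : Fin (n₀ + 1 + m) → ℂ) (w : Fin (n₀ + 1) → (Fin (n₀ + 1 + m) → ℂ)),
        (∀ i, mfderiv 𝓘(ℝ, Fin (n₀ + 1 + m) → ℂ) 𝓘(ℝ, Fin m → ℂ)
          (AlgPoints.map (familySpz ℂ (n₀ + 1) d sp)) y (w i) = 0) →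
        (show (Fin (n₀ + 1 + m) → ℂ) [⋀^Fin (n₀ + 1 + 1)]→L[ℝ] ℂ from mextDeriv (Ξ μ) y)
            (Fin.cons (I • v) w) =
          I * (show (Fin (n₀ + 1 + m) → ℂ) [⋀^Fin (n₀ + 1 + 1)]→L[ℝ] ℂ from mextDeriv (Ξ μ) y)
            (Fin.cons v w)) := by
  obtain ⟨O, hOo, ht₁O, h⟩ :=
    exists_relativeResidueForms_familySpz_of_isHomogeneous n₀ d sp hd m hf t₁
  have hP : ∀ μ : DegIndex (n₀ + 1) (d - (n₀ + 1 + 2)),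
      (MvPolynomial.monomial μ.1 (1 : ℂ)).IsHomogeneous (d - (n₀ + 1 + 2)) :=
    fun μ ↦ MvPolynomial.isHomogeneous_monomial _ μ.2
  choose Ξ h₁ h₂ h₃ h₄ using fun μ : DegIndex (n₀ + 1) (d - (n₀ + 1 + 2)) ↦ h _ (hP μ)
  exact ⟨O, hOo, ht₁O, Ξ, h₁, h₂, h₃, h₄⟩

end Forms

end Literature.AlgebraicGeometry.HodgeTheory

end
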